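import Summits.ValiantsHypothesis.ValiantsHypothesis.Theorems.GrenetZeonDualUnipotentThreeHalvesHeavyTopBand
import Summits.ValiantsHypothesis.ValiantsHypothesis.Theorems.DualUnipotentThreeHalves.Negative.FlagCheapOfTriangularisable

/-!
# `GrenetZeon.DualUnipotentThreeHalves` (stmt-ValiantsHypothesis-24318), R2 `HeavyTopLaw` — the INVARIANT-FLAG
# (graded Gerstenhaber) certificate for the finite instances `HeavyTopInst n m` (instrument, director-valiant R259 (a))

THEOREM G of the instance table `Cruxes/DualUnipotentThreeHalves/INSTANCES.md` (val-port-3 g2), in the kernel.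
Let `N` be an affine NILPOTENT `m × m` pencil over `ℂ^{n×n}` and let `P` be a constant change of basis after which
the whole pencil is BLOCK upper triangular for a level function `lvl : Fin m → ℕ` with `p` levels
(`(P N P⁻¹)_{ij} = 0` whenever `lvl i < lvl j`; equivalently the flag `F_t = P⁻¹·span{e_i : lvl i ≥ t}` is
invariant under every `N(x)`).  NO triangularisability is assumed: inside a level the pencil is arbitrary.  Put
`K := {v : every DIAGONAL BLOCK of P N_lin(v) P⁻¹ vanishes}`.  Then:

* on every line `x + s v`, `v ∈ K`, the constant flag `g = P`, levels `lvl`, `r = a = 0` is adapted with budget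
  `p − 1` (constant part block upper, top part strictly block upper);
* `codim K ≤ Σ_t C(m_t, 2)`, `m_t = #{i : lvl i = t}`: the `t`-th diagonal blocks of the conjugated tops form a
  linear space of NILPOTENT `m_t × m_t` matrices (diagonal blocks of block-triangular nilpotent matrices are
  nilpotent), so Gerstenhaber (✓ `Literature…finrank_le_choose_two`) bounds each block space.

Hence `flagCheap_of_block_levels` (core form: any `K` killing the diagonal blocks, `p·n < dim K`),
`flagCheap_of_invariant_levels`: `p·n + Σ_t C(m_t,2) < n² ⇒ FlagCheap n m N`, and the drop-`r`/climb-`c` variant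
`flagCheap_of_weight_levels` (WEIGHT flags: the pencil may LOWER levels by `r`, tops in `K` RAISE by `c`; budget
`⌊(p−1+r(n−1))/(c+r)⌋` — the card's «one-level-return flag» `p = 3, r = c = 1`).  G strictly contains the
triangularisable certificate (✓ p615665 `flagCheap_of_triangularisable_blocks`, ⧗ `flagCheap_of_triangularisable_levels`):
e.g. the codimension-one NON-triangularisable nilpotent space `[[Irr₃, *],[0, NT₃]] ⊂ M₆(ℂ)`
(`Irr₃ = span{E₁₂+E₂₃, E₂₁−E₃₂}`, Mathes–Omladič–Radjavi 1991 §5) is certified at format `(4,6)` by the flag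
`(3,3)`: `2·4 + 3 + 3 = 14 < 16`.  What the certificate cannot see is exactly a top-heavy pencil whose
invariant-subspace lattice is thin at every scale (irreducible spaces; INSTANCES.md §5 Q-irr).

Honest framing: a certificate for instances of the LAW R2; nothing here proves or refutes `HeavyTopLaw`, 24318, S3b
or 8062; `VP ≠ VNP` is not moved; no summit statement is proved here.  No definitions, no named facts.
[folklore + Gerstenhaber 1958 via the tree]
-/

noncomputable section

-- single-conjunct layout: Sub = Summit, duplicated namespace component intended
set_option linter.dupNamespace false

namespace Summit.ValiantsHypothesis.ValiantsHypothesis.Theorems.GrenetZeon.HeavyTopInvariantFlag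

open MvPolynomial Matrix
open scoped BigOperators
open Summit.ValiantsHypothesis.ValiantsHypothesis.Cruxes.TwoDimCoefficients.DimTwoCases (AffMat IsAffine)
open Summit.ValiantsHypothesis.ValiantsHypothesis.Theorems.GrenetZeon.RadicalSplit
open Summit.ValiantsHypothesis.ValiantsHypothesis.Theorems.DualUnipotentThreeHalvesNegative.FlagCost
  (coeff_aeval_line_eq_zero_of_two_le map_conj_algHom coeff_conj_apply top_map_aeval_line_eq_linPart)
open Literature.LinearAlgebra.Matrix.GerstenhaberNilpotentSubspace (finrank_le_choose_two)

variable {m : ℕ}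

/-! ## §1 Block-upper-triangular matrices: diagonal blocks of products and powers -/

/-- The product of two block-upper matrices (entries `(i,j)` with `lvl i < lvl j` vanish) is block upper. -/
theorem blockUpper_mul (lvl : Fin m → ℕ) (A B : Matrix (Fin m) (Fin m) ℂ)
    (hA : ∀ i j, lvl i < lvl j → A i j = 0) (hB : ∀ i j, lvl i < lvl j → B i j = 0) :
    ∀ i j, lvl i < lvl j → (A * B) i j = 0 := by
  intro i j hij
  rw [Matrix.mul_apply]
  refine Finset.sum_eq_zero fun l _ => ?_
  rcases lt_or_ge (lvl i) (lvl l) with h | h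
  · rw [hA i l h, zero_mul]
  · rw [hB l j (lt_of_le_of_lt h hij), mul_zero]

/-- A diagonal block of a product of block-upper matrices is the product of the diagonal blocks. -/
theorem toBlock_mul_of_blockUpper (lvl : Fin m → ℕ) (A B : Matrix (Fin m) (Fin m) ℂ)
    (hA : ∀ i j, lvl i < lvl j → A i j = 0) (hB : ∀ i j, lvl i < lvl j → B i j = 0) (t : ℕ) :
    (A * B).toBlock (fun i => lvl i = t) (fun i => lvl i = t) =
      A.toBlock (fun i => lvl i = t) (fun i => lvl i = t) * B.toBlock (fun i => lvl i = t) (fun i => lvl i = t) := by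
  classical
  rw [Matrix.toBlock_mul_eq_add (fun i => lvl i = t) (fun i => lvl i = t) (fun i => lvl i = t) A B]
  suffices h : (A.toBlock (fun i => lvl i = t) fun i => ¬ lvl i = t) *
      B.toBlock (fun i => ¬ lvl i = t) (fun i => lvl i = t) = 0 by
    rw [h, add_zero]
  ext i k
  rw [Matrix.mul_apply, Matrix.zero_apply]
  refine Finset.sum_eq_zero fun l _ => ?_
  rw [Matrix.toBlock_apply, Matrix.toBlock_apply]
  rcases lt_or_gt_of_ne l.2 with h | h
  · -- `lvl l < t = lvl k`
    rw [hB l k (by rw [k.2]; exact h), mul_zero]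
  · -- `lvl i = t < lvl l`
    rw [hA i l (by rw [i.2]; exact h), zero_mul]

/-- A diagonal block of a power of a block-upper matrix is the power of the diagonal block. -/
theorem toBlock_pow_of_blockUpper (lvl : Fin m → ℕ) (A : Matrix (Fin m) (Fin m) ℂ)
    (hA : ∀ i j, lvl i < lvl j → A i j = 0) (t : ℕ) :
    ∀ k : ℕ, (A ^ k).toBlock (fun i => lvl i = t) (fun i => lvl i = t) =
      (A.toBlock (fun i => lvl i = t) (fun i => lvl i = t)) ^ k
  | 0 => by
      ext i j
      simp only [pow_zero, Matrix.toBlock_apply, Matrix.one_apply, Subtype.ext_iff]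
  | k + 1 => by
      have hAk : ∀ i j, lvl i < lvl j → (A ^ k) i j = 0 := by
        induction k with
        | zero => intro i j hij; rw [pow_zero, Matrix.one_apply, if_neg (fun h => by rw [h] at hij; exact lt_irrefl _ hij)]
        | succ k ih => rw [pow_succ]; exact blockUpper_mul lvl _ _ ih hA
      rw [pow_succ, pow_succ, toBlock_mul_of_blockUpper lvl _ _ hAk hA, toBlock_pow_of_blockUpper lvl A hA t k]

/-- A diagonal block of a block-upper nilpotent matrix is nilpotent (after any reindexing). -/
theorem isNilpotent_reindex_toBlock (lvl : Fin m → ℕ) (A : Matrix (Fin m) (Fin m) ℂ)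
    (hA : ∀ i j, lvl i < lvl j → A i j = 0) (hnil : A ^ m = 0) (t : ℕ) {d : ℕ}
    (e : {i : Fin m // lvl i = t} ≃ Fin d) :
    IsNilpotent (Matrix.reindexAlgEquiv ℂ ℂ e (A.toBlock (fun i => lvl i = t) (fun i => lvl i = t))) := by
  refine ⟨m, ?_⟩
  rw [← map_pow, ← toBlock_pow_of_blockUpper lvl A hA t m, hnil]
  have : (0 : Matrix (Fin m) (Fin m) ℂ).toBlock (fun i => lvl i = t) (fun i => lvl i = t) = 0 := rfl
  rw [this, map_zero]

/-! ## §2 Affine pencils: the coefficient linear part is `N(v) − N(0)` -/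

/-- For an affine pencil, `N(v) − N(0) = (Σ_c v_c · coeff_{X_c} N_{ij})_{ij}`. [folklore] -/
theorem linPart_eq_coeff {n : ℕ} (N : AffMat n m) (hN : IsAffine N) (v : Fin n × Fin n → ℂ) :
    linPart N v = Matrix.of fun i j => ∑ c, v c * coeff (Finsupp.single c 1) (N i j) := by
  ext i j
  simp only [linPart, Matrix.sub_apply, Matrix.map_apply, Matrix.of_apply]
  have h := Literature.Computability.AlgebraicComplexity.DeterminantalConormal.eq_C_add_sum_of_totalDegree_le_one
    (hN i j)
  conv_lhs => rw [h]
  simp only [map_add, map_sum, map_mul, eval_C, eval_X, Pi.zero_apply, mul_zero, Finset.sum_const_zero,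
    add_zero, add_sub_cancel_left]
  exact Finset.sum_congr rfl fun c _ => mul_comm _ _

/-! ## §3 Theorem G: an invariant flag certifies flag-cheapness -/

/-- **THEOREM G, core form (invariant flag, explicit direction space).**  Let the affine pencil `N` be BLOCK upper
triangular after the constant change of basis `P` for the level function `lvl` with `p ≥ 1` levels
(`(P N P⁻¹)_{ij} = 0` whenever `lvl i < lvl j`), and let `K` be a direction space on which every DIAGONAL BLOCK of
the conjugated top `P N_lin(v) P⁻¹` vanishes.  If `p·n < dim K` then `FlagCheap n m N` (constant block flag,
budget `p − 1`).  Nothing is assumed inside the blocks; nilpotency is not even used. [folklore] -/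
theorem flagCheap_of_block_levels {n : ℕ} (N : AffMat n m) (hN : IsAffine N)
    (P : (Matrix (Fin m) (Fin m) ℂ)ˣ) (lvl : Fin m → ℕ) (p : ℕ) (hp : 1 ≤ p) (hlvl : ∀ i, lvl i < p)
    (hblock : ∀ i j : Fin m, lvl i < lvl j →
      ((P : Matrix (Fin m) (Fin m) ℂ).map C * N * (↑P⁻¹ : Matrix (Fin m) (Fin m) ℂ).map C :
        Matrix (Fin m) (Fin m) (MvPolynomial (Fin n × Fin n) ℂ)) i j = 0)
    (K : Submodule ℂ (Fin n × Fin n → ℂ))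
    (hK : ∀ v ∈ K, ∀ i j : Fin m, lvl i = lvl j →
      ((P : Matrix (Fin m) (Fin m) ℂ) * linPart N v * (↑P⁻¹ : Matrix (Fin m) (Fin m) ℂ)) i j = 0)
    (hdim : p * n < Module.finrank ℂ K) :
    FlagCheap n m N := by
  classical
  refine ⟨K, p - 1, fun x v hv => ⟨P, lvl, p, 0, 0, hlvl, ?_, ?_⟩, ?_⟩
  · -- budget p − 1
    simp [flagDeg]
  · -- adaptedness of the constant block flag
    intro i j d hd
    set φ : MvPolynomial (Fin n × Fin n) ℂ →ₐ[ℂ] MvPolynomial (Fin 1) ℂ :=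
      aeval fun c => (C (x c) + ∑ t : Fin 1, C (v c) * X t : MvPolynomial (Fin 1) ℂ) with hφ
    have hφ' : lineSubst x v = φ := rfl
    rw [hφ'] at hd
    -- block upper: the entry vanishes unless `lvl j ≤ lvl i`
    have hji : lvl j ≤ lvl i := by
      by_contra hlt
      apply hd
      rw [← map_conj_algHom φ, Matrix.map_apply, hblock i j (lt_of_not_ge hlt), map_zero, coeff_zero]
    have hcoeff := coeff_conj_apply (P : Matrix (Fin m) (Fin m) ℂ) (↑P⁻¹ : Matrix (Fin m) (Fin m) ℂ)
      (N.map φ) d i j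
    rcases Nat.lt_or_ge (d 0) 2 with hlt | hge
    · rcases Nat.lt_or_ge (d 0) 1 with h0 | h1
      · have hd0 : d 0 = 0 := by omega
        rw [hd0, mul_zero, zero_add, add_zero]
        exact hji
      · have hd1 : d 0 = 1 := by omega
        have hdeq : d = Finsupp.single 0 1 := Finsupp.ext fun t => by
          fin_cases t; simp [hd1]
        have htop : coeff d (((P : Matrix (Fin m) (Fin m) ℂ).map C * N.map φ *
            (↑P⁻¹ : Matrix (Fin m) (Fin m) ℂ).map C : Matrix (Fin m) (Fin m) (MvPolynomial (Fin 1) ℂ)) i j) =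
            ((P : Matrix (Fin m) (Fin m) ℂ) * linPart N v * (↑P⁻¹ : Matrix (Fin m) (Fin m) ℂ)) i j := by
          rw [hcoeff, hdeq, hφ, top_map_aeval_line_eq_linPart N hN x v, linPart_eq_coeff N hN]
        -- `v ∈ K`: the diagonal block of level `lvl i` vanishes, so `lvl i ≠ lvl j`
        have hne : lvl i ≠ lvl j := fun he => hd (htop.trans (hK v hv i j he))
        have hlt' : lvl j < lvl i := lt_of_le_of_ne hji (Ne.symm hne)
        rw [hd1]; omega
    · exfalso
      apply hd
      rw [hcoeff]
      have hz : (N.map φ).map (coeff d) = 0 := by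
        ext a b
        simp only [Matrix.map_apply, Matrix.zero_apply]
        exact coeff_aeval_line_eq_zero_of_two_le _ (hN a b) x v d hge
      rw [hz, Matrix.mul_zero, Matrix.zero_mul, Matrix.zero_apply]
  · -- dimension
    have h5 : p - 1 + 1 = p := Nat.sub_add_cancel hp
    rw [h5]; exact hdim

/-- **THEOREM G (invariant flag, graded Gerstenhaber).**  Let the affine NILPOTENT pencil `N` be BLOCK upper
triangular after the constant change of basis `P` for the level function `lvl` with `p` levels
(`(P N P⁻¹)_{ij} = 0` whenever `lvl i < lvl j`).  If `p·n + Σ_{t<p} C(#{i : lvl i = t}, 2) < n²` then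
`FlagCheap n m N`: `K = {v : the diagonal blocks of P N_lin(v) P⁻¹ vanish}` has codimension at most the sum of
the dimensions of the diagonal-block spaces of the conjugated tops, each a NILPOTENT linear space bounded by
Gerstenhaber.  No triangularisability inside the blocks is assumed. [folklore + Gerstenhaber 1958 via ✓
`finrank_le_choose_two`] -/
theorem flagCheap_of_invariant_levels {n : ℕ} (N : AffMat n m) (hN : IsAffine N) (hnil : N ^ m = 0)
    (P : (Matrix (Fin m) (Fin m) ℂ)ˣ) (lvl : Fin m → ℕ) (p : ℕ) (hp : 1 ≤ p) (hlvl : ∀ i, lvl i < p)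
    (hblock : ∀ i j : Fin m, lvl i < lvl j →
      ((P : Matrix (Fin m) (Fin m) ℂ).map C * N * (↑P⁻¹ : Matrix (Fin m) (Fin m) ℂ).map C :
        Matrix (Fin m) (Fin m) (MvPolynomial (Fin n × Fin n) ℂ)) i j = 0)
    (hbudget : p * n + ∑ t ∈ Finset.range p, (Fintype.card {i : Fin m // lvl i = t}).choose 2 < n ^ 2) :
    FlagCheap n m N := by
  classical
  -- the conjugated top map
  obtain ⟨T₀, hT₀⟩ := exists_topMap_linPart N hN
  let T : (Fin n × Fin n → ℂ) →ₗ[ℂ] Matrix (Fin m) (Fin m) ℂ :=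
    (LinearMap.mulRight ℂ (↑P⁻¹ : Matrix (Fin m) (Fin m) ℂ)) ∘ₗ
      (LinearMap.mulLeft ℂ (P : Matrix (Fin m) (Fin m) ℂ)) ∘ₗ T₀
  have hT : ∀ v, T v = (P : Matrix (Fin m) (Fin m) ℂ) * linPart N v * (↑P⁻¹ : Matrix (Fin m) (Fin m) ℂ) := by
    intro v
    simp only [T, LinearMap.coe_comp, Function.comp_apply, LinearMap.mulLeft_apply, LinearMap.mulRight_apply, hT₀]
  -- every conjugated top is block upper and nilpotent
  have hTblock : ∀ v i j, lvl i < lvl j → T v i j = 0 := by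
    intro v i j hij
    set φ : MvPolynomial (Fin n × Fin n) ℂ →ₐ[ℂ] MvPolynomial (Fin 1) ℂ :=
      aeval fun c => (C ((0 : Fin n × Fin n → ℂ) c) + ∑ t : Fin 1, C (v c) * X t : MvPolynomial (Fin 1) ℂ)
      with hφ
    have h1 : coeff (Finsupp.single 0 1) (((P : Matrix (Fin m) (Fin m) ℂ).map C * N.map φ *
        (↑P⁻¹ : Matrix (Fin m) (Fin m) ℂ).map C : Matrix (Fin m) (Fin m) (MvPolynomial (Fin 1) ℂ)) i j) = T v i j := by
      rw [coeff_conj_apply, hφ, top_map_aeval_line_eq_linPart N hN 0 v, hT, linPart_eq_coeff N hN]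
    rw [← h1, ← map_conj_algHom φ, Matrix.map_apply, hblock i j hij, map_zero, coeff_zero]
  have hTnil : ∀ v, T v ^ m = 0 := by
    intro v
    have hconj : ∀ k : ℕ, ((P : Matrix (Fin m) (Fin m) ℂ) * linPart N v * (↑P⁻¹ : Matrix (Fin m) (Fin m) ℂ)) ^ k =
        (P : Matrix (Fin m) (Fin m) ℂ) * linPart N v ^ k * (↑P⁻¹ : Matrix (Fin m) (Fin m) ℂ) := by
      intro k
      induction k with
      | zero => simp
      | succ k ih =>
          rw [pow_succ, ih, pow_succ]
          simp only [Matrix.mul_assoc]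
          congr 1
          rw [← Matrix.mul_assoc (↑P⁻¹ : Matrix (Fin m) (Fin m) ℂ), Units.inv_mul, Matrix.one_mul,
            ← Matrix.mul_assoc]
    rw [hT, hconj, linPart_pow_eq_zero N hN hnil v, Matrix.mul_zero, Matrix.zero_mul]
  -- the block spaces: sizes, reindexing, and the diagonal-block maps
  let sz : Fin p → ℕ := fun t => Fintype.card {i : Fin m // lvl i = (t : ℕ)}
  let e : ∀ t : Fin p, {i : Fin m // lvl i = (t : ℕ)} ≃ Fin (sz t) := fun t => Fintype.equivFin _
  let blk : ∀ t : Fin p, Matrix (Fin m) (Fin m) ℂ →ₗ[ℂ] Matrix (Fin (sz t)) (Fin (sz t)) ℂ := fun t =>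
    (Matrix.reindexAlgEquiv ℂ ℂ (e t)).toLinearEquiv.toLinearMap ∘ₗ
      { toFun := fun A => A.toBlock (fun i => lvl i = (t : ℕ)) (fun i => lvl i = (t : ℕ))
        map_add' := fun A B => rfl
        map_smul' := fun c A => rfl }
  have hblk : ∀ (t : Fin p) (A : Matrix (Fin m) (Fin m) ℂ),
      blk t A = Matrix.reindexAlgEquiv ℂ ℂ (e t) (A.toBlock (fun i => lvl i = (t : ℕ)) (fun i => lvl i = (t : ℕ))) :=
    fun t A => rfl
  let Φ : (Fin n × Fin n → ℂ) →ₗ[ℂ] (∀ t : Fin p, Matrix (Fin (sz t)) (Fin (sz t)) ℂ) :=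
    LinearMap.pi fun t => blk t ∘ₗ T
  have hΦ : ∀ v t, Φ v t = blk t (T v) := fun v t => rfl
  -- Gerstenhaber on each block space
  have hD : ∀ t : Fin p, Module.finrank ℂ (LinearMap.range (blk t ∘ₗ T)) ≤ (sz t).choose 2 := by
    intro t
    refine finrank_le_choose_two (sz t) _ fun A hA => ?_
    obtain ⟨v, rfl⟩ := LinearMap.mem_range.1 hA
    rw [LinearMap.comp_apply, hblk]
    exact isNilpotent_reindex_toBlock lvl (T v) (hTblock v) (hTnil v) (t : ℕ) (e t)
  -- the range of `Φ` embeds into the product of the block spaces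
  have hrange : Module.finrank ℂ (LinearMap.range Φ) ≤ ∑ t : Fin p, (sz t).choose 2 := by
    let ι : LinearMap.range Φ →ₗ[ℂ] (∀ t : Fin p, LinearMap.range (blk t ∘ₗ T)) :=
      LinearMap.pi fun t =>
        { toFun := fun x => ⟨x.1 t, by
            obtain ⟨v, hv⟩ := LinearMap.mem_range.1 x.2
            exact LinearMap.mem_range.2 ⟨v, by rw [← hv]; rfl⟩⟩
          map_add' := fun x y => rfl
          map_smul' := fun c x => rfl }
    have hι : Function.Injective ι := by
      intro x y hxy
      apply Subtype.ext
      funext t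
      have := congr_arg (fun f => ((f t : LinearMap.range (blk t ∘ₗ T)) : Matrix (Fin (sz t)) (Fin (sz t)) ℂ))
        hxy
      exact this
    calc Module.finrank ℂ (LinearMap.range Φ)
        ≤ Module.finrank ℂ (∀ t : Fin p, LinearMap.range (blk t ∘ₗ T)) :=
          LinearMap.finrank_le_finrank_of_injective hι
      _ = ∑ t : Fin p, Module.finrank ℂ (LinearMap.range (blk t ∘ₗ T)) := Module.finrank_pi_fintype ℂ
      _ ≤ ∑ t : Fin p, (sz t).choose 2 := Finset.sum_le_sum fun t _ => hD t
  have hsum : ∑ t : Fin p, (sz t).choose 2 = ∑ t ∈ Finset.range p, (Fintype.card {i : Fin m // lvl i = t}).choose 2 :=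
    Fin.sum_univ_eq_sum_range (fun t => (Fintype.card {i : Fin m // lvl i = t}).choose 2) p
  -- apply the core form with `K = ker Φ`
  refine flagCheap_of_block_levels N hN P lvl p hp hlvl hblock (LinearMap.ker Φ) (fun v hv i j he => ?_) ?_
  · have hv0 : Φ v = 0 := LinearMap.mem_ker.mp hv
    have hb : blk ⟨lvl i, hlvl i⟩ (T v) = 0 := by rw [← hΦ, hv0]; rfl
    rw [hblk, map_eq_zero_iff _ (Matrix.reindexAlgEquiv ℂ ℂ _).injective] at hb
    have h0 := congr_fun (congr_fun hb ⟨i, rfl⟩) ⟨j, he.symm⟩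
    rw [Matrix.toBlock_apply, Matrix.zero_apply] at h0
    rw [← hT]; exact h0
  · have h1 := LinearMap.finrank_range_add_finrank_ker Φ
    have h3 : Module.finrank ℂ (Fin n × Fin n → ℂ) = n * n := by
      rw [Module.finrank_fintype_fun_eq_card, Fintype.card_prod, Fintype.card_fin]
    have h4 : n ^ 2 = n * n := sq n
    rw [← hsum] at hbudget
    omega

/-! ## §3b Theorem G″: weight flags with drop `r` and climb `c` (the «one-level-return» flags of the card) -/

/-- **THEOREM G″, core form (weight flag with drop `r`, climb `c`).**  Let `lvl` be a level function with `p ≥ 1`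
levels and let the affine pencil, after the constant change of basis `P`, LOWER levels by at most `r`
(`(P N P⁻¹)_{ij} = 0` whenever `lvl i + r < lvl j` — constant part and all tops alike).  Let `K` be a direction
space whose conjugated tops RAISE levels by at least `c ≥ 1` (`(P N_lin(v) P⁻¹)_{ij} = 0` whenever
`lvl i < lvl j + c`).  If `(k+1)·n < dim K` with `k = ⌊(p − 1 + r(n−1))/(c + r)⌋` then `FlagCheap n m N` (constant
weight flag, drop `r`, weight `a + 1 = c + r`).  For `r = 0`, `c = 1` this is `flagCheap_of_block_levels`; `p = 3`,
`r = c = 1` is the card's «one-level-return flag» for the heavy-top families `L_k`, `B(a,b)`. [folklore] -/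
theorem flagCheap_of_weight_levels {n : ℕ} (N : AffMat n m) (hN : IsAffine N)
    (P : (Matrix (Fin m) (Fin m) ℂ)ˣ) (lvl : Fin m → ℕ) (p r c : ℕ) (hc : 1 ≤ c) (hlvl : ∀ i, lvl i < p)
    (hdrop : ∀ i j : Fin m, lvl i + r < lvl j →
      ((P : Matrix (Fin m) (Fin m) ℂ).map C * N * (↑P⁻¹ : Matrix (Fin m) (Fin m) ℂ).map C :
        Matrix (Fin m) (Fin m) (MvPolynomial (Fin n × Fin n) ℂ)) i j = 0)
    (K : Submodule ℂ (Fin n × Fin n → ℂ))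
    (hK : ∀ v ∈ K, ∀ i j : Fin m, lvl i < lvl j + c →
      ((P : Matrix (Fin m) (Fin m) ℂ) * linPart N v * (↑P⁻¹ : Matrix (Fin m) (Fin m) ℂ)) i j = 0)
    (k : ℕ) (hk : (p - 1 + r * (n - 1)) / (c + r) ≤ k) (hdim : (k + 1) * n < Module.finrank ℂ K) :
    FlagCheap n m N := by
  classical
  refine ⟨K, k, fun x v hv => ⟨P, lvl, p, r, c + r - 1, hlvl, ?_, ?_⟩, hdim⟩
  · -- budget
    have h1 : c + r - 1 + 1 = c + r := by omega
    simp only [flagDeg, h1]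
    exact hk
  · -- adaptedness of the constant weight flag
    intro i j d hd
    have h1 : c + r - 1 + 1 = c + r := by omega
    rw [h1]
    set φ : MvPolynomial (Fin n × Fin n) ℂ →ₐ[ℂ] MvPolynomial (Fin 1) ℂ :=
      aeval fun c' => (C (x c') + ∑ t : Fin 1, C (v c') * X t : MvPolynomial (Fin 1) ℂ) with hφ
    have hφ' : lineSubst x v = φ := rfl
    rw [hφ'] at hd
    -- drop at most `r`: the entry vanishes unless `lvl j ≤ lvl i + r`
    have hji : lvl j ≤ lvl i + r := by
      by_contra hlt
      apply hd
      rw [← map_conj_algHom φ, Matrix.map_apply, hdrop i j (lt_of_not_ge hlt), map_zero, coeff_zero]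
    have hcoeff := coeff_conj_apply (P : Matrix (Fin m) (Fin m) ℂ) (↑P⁻¹ : Matrix (Fin m) (Fin m) ℂ)
      (N.map φ) d i j
    rcases Nat.lt_or_ge (d 0) 2 with hlt | hge
    · rcases Nat.lt_or_ge (d 0) 1 with h0 | h1'
      · have hd0 : d 0 = 0 := by omega
        rw [hd0, mul_zero, zero_add]
        exact hji
      · have hd1 : d 0 = 1 := by omega
        have hdeq : d = Finsupp.single 0 1 := Finsupp.ext fun t => by
          fin_cases t; simp [hd1]
        have htop : coeff d (((P : Matrix (Fin m) (Fin m) ℂ).map C * N.map φ *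
            (↑P⁻¹ : Matrix (Fin m) (Fin m) ℂ).map C : Matrix (Fin m) (Fin m) (MvPolynomial (Fin 1) ℂ)) i j) =
            ((P : Matrix (Fin m) (Fin m) ℂ) * linPart N v * (↑P⁻¹ : Matrix (Fin m) (Fin m) ℂ)) i j := by
          rw [hcoeff, hdeq, hφ, top_map_aeval_line_eq_linPart N hN x v, linPart_eq_coeff N hN]
        -- `v ∈ K`: the top climbs by at least `c`
        have hcl : lvl j + c ≤ lvl i := by
          by_contra hlt'
          exact hd (htop.trans (hK v hv i j (lt_of_not_ge hlt')))
        rw [hd1]; omega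
    · exfalso
      apply hd
      rw [hcoeff]
      have hz : (N.map φ).map (coeff d) = 0 := by
        ext a b
        simp only [Matrix.map_apply, Matrix.zero_apply]
        exact coeff_aeval_line_eq_zero_of_two_le _ (hN a b) x v d hge
      rw [hz, Matrix.mul_zero, Matrix.zero_mul, Matrix.zero_apply]

/-! ## §4 The codimension-one non-triangularisable example is certified at format `(4,6)` -/

/-- Format `(4, 6)`, blocks `(3,3)`: `Σ_t C(m_t,2) = 3 + 3 = 6`. -/
theorem sum_choose_two_six_three :
    ∑ t ∈ Finset.range 2, (Fintype.card {i : Fin 6 // (5 - (i : ℕ)) / 3 = t}).choose 2 = 6 := by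
  decide

/-- **Format `(4,6)` by the invariant-flag certificate**: an affine nilpotent `6 × 6` pencil over `ℂ^{4×4}`
that is `(3,3)`-BLOCK upper triangular after one constant change of basis (an invariant `3`-space — nothing is
assumed inside the two blocks) is flag-cheap: `2·4 + 3 + 3 = 14 < 16`.  This certifies e.g. every pencil with
top space inside the non-triangularisable `[[Irr₃, *],[0, NT₃]]`. [this file] -/
theorem flagCheap_four_six_of_block_three_three (N : AffMat 4 6) (hN : IsAffine N) (hnil : N ^ 6 = 0)
    (P : (Matrix (Fin 6) (Fin 6) ℂ)ˣ)
    (hblock : ∀ i j : Fin 6, (5 - (i : ℕ)) / 3 < (5 - (j : ℕ)) / 3 →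
      ((P : Matrix (Fin 6) (Fin 6) ℂ).map C * N * (↑P⁻¹ : Matrix (Fin 6) (Fin 6) ℂ).map C :
        Matrix (Fin 6) (Fin 6) (MvPolynomial (Fin 4 × Fin 4) ℂ)) i j = 0) :
    FlagCheap 4 6 N := by
  refine flagCheap_of_invariant_levels N hN hnil P (fun i => (5 - (i : ℕ)) / 3) 2 (by norm_num)
    (fun i => by have := i.isLt; omega) hblock ?_
  rw [sum_choose_two_six_three]; norm_num

end Summit.ValiantsHypothesis.ValiantsHypothesis.Theorems.GrenetZeon.HeavyTopInvariantFlag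

end
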